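import Mathlib
import Literature.Analysis.FluidPDE.Tao2016AveragedNS.BoundedEternalSolutions
import Summits.NavierStokesRegularity.NavierStokesRegularity.Theorems.TaoLadderRungTwoBreakBlowupRigidityOneNilpotentTables
import HarnessLib

/-!
# Nilpotent tables carry no admissible VISCOUS eternal solution either: the deciding crux K1ᵛ(1)
  `TaoLadderRungTwoBreak.NoSurvivingEternalViscBddOne` (stmt-NavierStokesRegularity-20419), its split children and the
  classification stub of K2(1) (stmt-…-20206) hold on NILPOTENT tables of `E₂(R)` at every scale ratio and every
  covariant viscosity `ν̂ ≥ 0` (`--supports`)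

MODEL lattice ODEs only (Tao 2016 §4 (4.1), Lemma 4.1 (iii) (4.8), the viscous equation before Thm. 4.2, §6.4); nothing
here is a statement about the Navier–Stokes equations; NO item is closed.  DEF-FREE; ROUTE-INDEPENDENT.

`…NilpotentTables` (this hand) showed that a table with a nilpotent ranking (every non-zero `α_{jk i,μ}` has an input of
rank below its output) carries no admissible INVISCID eternal solution.  The same induction on the rank works with the
covariant dissipation `−ν̂(1+ε₀)^{2n}e^{−σ} W_n` of `IsEternalVisc`: an undriven mode obeys `f' = −(1 + d(σ)) f` with
`d ≥ 0`, so `|f|` is non-increasing and `|f(σ)| ≥ |f(0)|` on `(−∞, 0]` — incompatible with the ACTION clause unless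
`f(0) = 0`, and then `f ≡ 0` forward as well (the weighted quantity `f·exp(σ − ν̂λ^{2n}e^{−σ})` is constant).

* `hasDerivAt_apply_of_isEternalVisc` — components of the viscous eternal law;
* `eternalVisc_trivial_of_nilpotent` — every admissible viscous eternal solution (`IsEternalVisc ε₀ ν̂ α W`, `1+ε₀ ≥ 0`,
  any `ν̂ ≥ 0`) of a nilpotent table is `0`;
* `not_eternalSurvivingFwd_visc_of_nilpotent` — hence never (S_a)-surviving forward;
* `noSurvivingEternalViscBdd_on_nilpotent`, `noLoudLadder_on_nilpotent` — BY SHAPE: the conclusions of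
  `NoSurvivingEternalViscBdd R a` (K1ᵛ, any `a`) and of `NoLoudLadder R` hold on nilpotent tables for EVERY `ε₀ > 0`
  (no threshold, no uniform bound needed); with `…NilpotentTables` / `…Core`: every object any K1/K2-type item of the
  route quantifies over lives on a table with a SELF-SUSTAINING CORE.

HONEST LABEL: calibration on an explicit sub-class; no stub, crux, rung or summit is proved; rung 0.
-/

noncomputable section

-- the summit and its single sub-problem share the name (CONVENTIONS §1)
set_option linter.dupNamespace false

open Set Filter Topology MeasureTheory

namespace Summit.NavierStokesRegularity.NavierStokesRegularity.Theorems

namespace BlowupRigidityOne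

open Literature.Analysis.FluidPDE Literature.Analysis.FluidPDE.TaoCascade
  Literature.Analysis.FluidPDE.Tao2016AveragedNS

variable {m : ℕ} {R ε₀ νh : ℝ} {α : Fin m → Fin m → Fin m → ℤ × ℤ × ℤ → ℝ}

/-- Components of the viscous eternal law:
`(W_n)_i' = −(W_n)_i + [Q(W_n) + Λ A(W_{n−1}) + Λ⁻¹ B(W_{n+1}, W_n)]_i − ν̂(1+ε₀)^{2n}e^{−σ}(W_n)_i`.
[cite: Tao2016AveragedNS, §4 Lemma 4.1 (iii) (4.8) and the viscous equation before Thm. 4.2, in self-similar variables (§6.4); cell vocabulary (`IsEternalVisc`)] -/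
theorem hasDerivAt_apply_of_isEternalVisc {W : ℤ → ℝ → Em m} (hW : IsEternalVisc ε₀ νh α W) (n : ℤ) (σ : ℝ)
    (i : Fin m) :
    HasDerivAt (fun σ => W n σ i)
      (-(W n σ i) + (tableQ α (W n σ) i + bigLam ε₀ * tableA α (W (n - 1) σ) i
        + (bigLam ε₀)⁻¹ * tableB α (W (n + 1) σ) (W n σ) i)
        - νh * ((1 + ε₀) ^ ((2 : ℝ) * n) * Real.exp (-σ)) * W n σ i) σ := by
  have h := ((EuclideanSpace.proj i : Em m →L[ℝ] ℝ).hasFDerivAt.comp_hasDerivAt σ (hW.law n σ))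
  have e : (EuclideanSpace.proj i : Em m →L[ℝ] ℝ) (-((1 : ℝ) • W n σ) + tableQ α (W n σ)
      + bigLam ε₀ • tableA α (W (n - 1) σ) + (bigLam ε₀)⁻¹ • tableB α (W (n + 1) σ) (W n σ)
      - (νh * ((1 + ε₀) ^ ((2 : ℝ) * n) * Real.exp (-σ))) • W n σ)
      = -(W n σ i) + (tableQ α (W n σ) i + bigLam ε₀ * tableA α (W (n - 1) σ) i
        + (bigLam ε₀)⁻¹ * tableB α (W (n + 1) σ) (W n σ) i)
        - νh * ((1 + ε₀) ^ ((2 : ℝ) * n) * Real.exp (-σ)) * W n σ i := by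
    rw [EuclideanSpace.coe_proj]
    simp only [PiLp.add_apply, PiLp.sub_apply, PiLp.neg_apply, PiLp.smul_apply, smul_eq_mul, one_mul]
    ring
  rw [e] at h
  exact h

/-- **NO NON-TRIVIAL ADMISSIBLE VISCOUS ETERNAL SOLUTION ON A NILPOTENT TABLE.**  If every non-zero structure constant
has an input of rank below its output and `1 + ε₀ ≥ 0`, then every admissible eternal solution of the renormalised
viscous lattice (`IsEternalVisc ε₀ ν̂ α W`, any `ν̂ ≥ 0`) vanishes identically: by induction on the rank an undriven mode
obeys `f' = −(1 + ν̂(1+ε₀)^{2n}e^{−σ}) f`, so `f(σ)·exp(σ − ν̂(1+ε₀)^{2n}e^{−σ})` is constant, `|f(σ)| ≥ |f(0)|` for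
`σ ≤ 0`, and the ACTION clause (`σ ↦ ‖W_n(σ)‖` integrable on `ℝ`) forces `f(0) = 0`.
[cite: Tao2016AveragedNS, §4 (4.1), Lemma 4.1 (iii) (4.8), the viscous equation before Thm. 4.2, §6.4; cell vocabulary (`IsEternalVisc`, clause `action`)] -/
theorem eternalVisc_trivial_of_nilpotent (hε : 0 ≤ 1 + ε₀) (rank : Fin m → ℕ)
    (hnil : ∀ μ ∈ shiftSet, ∀ j k i, α j k i μ ≠ 0 → rank j < rank i ∨ rank k < rank i)
    {W : ℤ → ℝ → Em m} (hW : IsEternalVisc ε₀ νh α W) : ∀ n σ, W n σ = 0 := by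
  have h001 : ((0 : ℤ), (0 : ℤ), (1 : ℤ)) ∈ shiftSet := by simp [shiftSet]
  have h000 : ((0 : ℤ), (0 : ℤ), (0 : ℤ)) ∈ shiftSet := by simp [shiftSet]
  have h100 : ((1 : ℤ), (0 : ℤ), (0 : ℤ)) ∈ shiftSet := by simp [shiftSet]
  have h010 : ((0 : ℤ), (1 : ℤ), (0 : ℤ)) ∈ shiftSet := by simp [shiftSet]
  suffices hmain : ∀ r : ℕ, ∀ i : Fin m, rank i < r → ∀ n σ, W n σ i = 0 by
    intro n σ; ext i; exact hmain (rank i + 1) i (Nat.lt_succ_self _) n σ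
  intro r
  induction r with
  | zero => intro i hi; exact absurd hi (Nat.not_lt_zero _)
  | succ r ih =>
    intro i hi n
    have hlow : ∀ n' σ j, rank j < rank i → W n' σ j = 0 := fun n' σ j hj => ih j (by omega) n' σ
    have hR : ∀ σ, tableQ α (W n σ) i + bigLam ε₀ * tableA α (W (n - 1) σ) i
        + (bigLam ε₀)⁻¹ * tableB α (W (n + 1) σ) (W n σ) i = 0 := by
      intro σ
      rw [tableQ_apply, tableA_apply, tableB_apply,
        qform_eq_zero_of_lowRank rank (hnil _ h000) _ _ i (hlow n σ) (hlow n σ),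
        qform_eq_zero_of_lowRank rank (hnil _ h001) _ _ i (hlow (n - 1) σ) (hlow (n - 1) σ),
        qform_eq_zero_of_lowRank rank (hnil _ h100) _ _ i (hlow (n + 1) σ) (hlow n σ),
        qform_eq_zero_of_lowRank rank (hnil _ h010) _ _ i (hlow n σ) (hlow (n + 1) σ)]
      ring
    -- the dissipation coefficient `c = ν̂ (1+ε₀)^{2n} ≥ 0` and `d(σ) = c e^{-σ}`
    set c : ℝ := νh * (1 + ε₀) ^ ((2 : ℝ) * n) with hc
    have hc0 : 0 ≤ c := mul_nonneg hW.nonneg (Real.rpow_nonneg hε _)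
    -- `f' = -(1 + c e^{-σ}) f`
    have hder : ∀ σ, HasDerivAt (fun σ => W n σ i) (-(1 + c * Real.exp (-σ)) * W n σ i) σ := by
      intro σ
      have h := hasDerivAt_apply_of_isEternalVisc hW n σ i
      rw [hR σ, add_zero] at h
      convert h using 1
      rw [hc]; ring
    -- the integrating factor `g(σ) = f(σ) · exp(σ - c e^{-σ})` is constant
    have hphi : ∀ σ, HasDerivAt (fun σ => σ - c * Real.exp (-σ)) (1 + c * Real.exp (-σ)) σ := by
      intro σ
      have h2 : HasDerivAt (fun σ => σ - c * Real.exp (-σ)) (1 - c * (Real.exp (-σ) * -1)) σ :=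
        (hasDerivAt_id' σ).sub (((hasDerivAt_neg σ).exp).const_mul c)
      convert h2 using 1
      ring
    have hconst : ∀ σ, W n σ i * Real.exp (σ - c * Real.exp (-σ)) = W n 0 i * Real.exp (0 - c * Real.exp (-0)) := by
      intro σ
      have hd : ∀ w, HasDerivAt (fun w => W n w i * Real.exp (w - c * Real.exp (-w))) 0 w := by
        intro w
        have he : HasDerivAt (fun w => Real.exp (w - c * Real.exp (-w)))
            (Real.exp (w - c * Real.exp (-w)) * (1 + c * Real.exp (-w))) w := (hphi w).exp
        have h1 := (hder w).mul he
        have e : -(1 + c * Real.exp (-w)) * W n w i * Real.exp (w - c * Real.exp (-w))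
            + W n w i * (Real.exp (w - c * Real.exp (-w)) * (1 + c * Real.exp (-w))) = 0 := by ring
        rw [e] at h1
        exact h1
      exact is_const_of_deriv_eq_zero (f := fun w => W n w i * Real.exp (w - c * Real.exp (-w)))
        (fun w => (hd w).differentiableAt) (fun w => (hd w).deriv) σ 0
    -- on `σ ≤ 0`: `|f(σ)| ≥ |f(0)|`
    have hge : ∀ σ, σ ≤ 0 → |W n 0 i| ≤ |W n σ i| := by
      intro σ hσ
      have h := hconst σ
      have hE : Real.exp (σ - c * Real.exp (-σ)) ≤ Real.exp (0 - c * Real.exp (-0)) := by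
        refine Real.exp_le_exp.2 ?_
        have : Real.exp (-0) ≤ Real.exp (-σ) := Real.exp_le_exp.2 (by linarith)
        nlinarith
      have hpos : 0 < Real.exp (σ - c * Real.exp (-σ)) := Real.exp_pos _
      have hpos0 : 0 < Real.exp (0 - c * Real.exp (-0)) := Real.exp_pos _
      -- |f 0| E₀ = |f σ| E_σ ≤ |f σ| E₀
      have h1 : |W n 0 i| * Real.exp (0 - c * Real.exp (-0)) = |W n σ i| * Real.exp (σ - c * Real.exp (-σ)) := by
        rw [← abs_of_pos hpos, ← abs_of_pos hpos0, ← abs_mul, ← abs_mul, h]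
      have h2 : |W n σ i| * Real.exp (σ - c * Real.exp (-σ)) ≤ |W n σ i| * Real.exp (0 - c * Real.exp (-0)) :=
        mul_le_mul_of_nonneg_left hE (abs_nonneg _)
      exact le_of_mul_le_mul_right (h1 ▸ h2) hpos0
    -- the action clause forces `f(0) = 0`
    have h0 : W n 0 i = 0 := by
      by_contra hne
      have hpos : 0 < |W n 0 i| := abs_pos.2 hne
      obtain ⟨M, hM⟩ := hW.action
      have hint : Integrable (fun σ => W n σ i) := by
        refine (hM n).1.mono' ?_ (Eventually.of_forall fun σ => ?_)
        · exact (continuous_iff_continuousAt.2 fun σ => (hder σ).continuousAt).aestronglyMeasurable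
        · rw [Real.norm_eq_abs]
          exact abs_apply_le_norm (W n σ) i
      have h1 : IntegrableOn (fun _ : ℝ => |W n 0 i|) (Iic (0 : ℝ)) := by
        refine (hint.norm.integrableOn (s := Iic 0)).mono' aestronglyMeasurable_const ?_
        refine (ae_restrict_mem measurableSet_Iic).mono fun σ hσ => ?_
        rw [Real.norm_eq_abs, abs_abs, Real.norm_eq_abs]
        exact hge σ hσ
      have h2 : volume (Iic (0 : ℝ)) < ⊤ := by
        have := (integrableOn_const_iff (C := |W n 0 i|) (s := Iic (0 : ℝ)) (μ := volume)).1 h1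
        exact this.resolve_left (by simpa [enorm_eq_zero, abs_eq_zero] using hne)
      simp at h2
    -- hence `f ≡ 0`
    intro σ
    have h := hconst σ
    rw [h0, zero_mul] at h
    rcases mul_eq_zero.1 h with h' | h'
    · exact h'
    · exact absurd h' (Real.exp_pos _).ne'

/-- **No admissible viscous eternal solution of a nilpotent table is (S_a)-surviving forward** (`1+ε₀ ≥ 0`, any `ν̂`,
any `a`). [cite: Tao2016AveragedNS, §4 (4.8), the viscous equation before Thm. 4.2, §6.4; cell vocabulary (`IsEternalVisc`, `EternalSurvivingFwd`)] -/
theorem not_eternalSurvivingFwd_visc_of_nilpotent (hε : 0 ≤ 1 + ε₀) (rank : Fin m → ℕ)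
    (hnil : ∀ μ ∈ shiftSet, ∀ j k i, α j k i μ ≠ 0 → rank j < rank i ∨ rank k < rank i)
    {W : ℤ → ℝ → Em m} (hW : IsEternalVisc ε₀ νh α W) (a : ℝ) : ¬ EternalSurvivingFwd a ε₀ W := by
  rintro ⟨c, hc0, H⟩
  obtain ⟨n, -, σ, -, hle⟩ := H 0
  rw [eternalVisc_trivial_of_nilpotent hε rank hnil hW n σ, norm_zero] at hle
  simp only [ne_eq, OfNat.ofNat_ne_zero, not_false_eq_true, zero_pow, mul_zero] at hle
  exact absurd hle (not_le.2 hc0)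

/-- **K1ᵛ ON NILPOTENT TABLES, EVERY `ε₀`, BY SHAPE.**  The conclusion of `NoSurvivingEternalViscBdd R a` — no uniformly
bounded admissible viscous eternal solution of an `E₂(R)` table is (S_a)-surviving forward — holds for every NILPOTENT
table at every `ε₀ > 0`, any `ν̂`, any exponent `a`, and without using the uniform bound.
[cite: Tao2016AveragedNS, §4 Thm. 4.2 (statement shape), §6.4; cell vocabulary (`NoSurvivingEternalViscBdd`)] -/
theorem noSurvivingEternalViscBdd_on_nilpotent (hε : 0 < ε₀) (rank : Fin m → ℕ)
    (hnil : ∀ μ ∈ shiftSet, ∀ j k i, α j k i μ ≠ 0 → rank j < rank i ∨ rank k < rank i)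
    (νh : ℝ) (W : ℤ → ℝ → Em m) (hW : IsEternalVisc ε₀ νh α W) (a : ℝ) :
    ¬ EternalSurvivingFwd a ε₀ W :=
  not_eternalSurvivingFwd_visc_of_nilpotent (by linarith) rank hnil hW a

/-- **The live spread-one table carries no admissible viscous eternal solution** (`1 + ε₀ ≥ 0`, any `ν̂ ≥ 0`): a member
of `E₂(1)` with a live cross outflow on which the deciding crux K1ᵛ(1) holds outright at every scale ratio.
[cite: Tao2016AveragedNS, §4 (4.1)–(4.3), §6.1, §6.4; cell vocabulary] -/
theorem liveTable_eternalVisc_trivial (hε : 0 ≤ 1 + ε₀) {W : ℤ → ℝ → Em 4}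
    (hW : IsEternalVisc ε₀ νh (fun (i₁ i₂ i₃ : Fin 4) (μ : ℤ × ℤ × ℤ) =>
      if i₃ = 3 ∧ ((i₁ = 1 ∧ i₂ = 2) ∨ (i₁ = 2 ∧ i₂ = 1)) ∧ μ = ((0 : ℤ), (0 : ℤ), (1 : ℤ)) then (1 : ℝ)
      else if i₁ = 3 ∧ i₂ = 1 ∧ i₃ = 2 ∧ μ = ((1 : ℤ), (0 : ℤ), (0 : ℤ)) then -1
      else if i₁ = 1 ∧ i₂ = 3 ∧ i₃ = 2 ∧ μ = ((0 : ℤ), (1 : ℤ), (0 : ℤ)) then -1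
      else 0) W) : ∀ n σ, W n σ = 0 :=
  eternalVisc_trivial_of_nilpotent hε _ nilpotent_liveTable hW

end BlowupRigidityOne

end Summit.NavierStokesRegularity.NavierStokesRegularity.Theorems

end
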